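import Mathlib.Algebra.FreeAlgebra
import Mathlib.LinearAlgebra.Alternating.Uncurry.Fin
import Mathlib.LinearAlgebra.Dimension.Constructions
import Mathlib.LinearAlgebra.Dimension.Finite
import Mathlib.LinearAlgebra.Matrix.ToLin
import HarnessLib

/-!
# Alternating central polynomials of `M_n` and the Azumaya identity (Artin–Procesi / Razmyslov)

Topic `Literature/RingTheory/PolynomialIdentities`. Source: A. Kanel-Belov, Y. Karasik, L. H. Rowen,
*Computational Aspects of Polynomial Identities, Vol. I*, 2nd ed., CRC (2015), §1.5.2 "Applications of
alternating central polynomials": Remark F (from a multilinear central polynomial `g` of `M_n(ℚ)` and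
the Capelli polynomial `c_{n²}` one gets `h_n = g(c_{n²}(x⃗, y⃗), …)`, a multilinear, `n²`-alternating
polynomial which is central and not an identity on every algebra of PI-class `n`), Lemma G (for `h`
`t`-alternating, `h̃ = h - Σ_{i ≤ t} (-1)^i h(…, x_i ↔ x_{t+1}, …)` is `(t+1)`-alternating), eq. (1.21)
(hence, on an algebra satisfying the Capelli identity `c_{t+1}`,
`(-1)^t h(a_1, …, a_{t+1}; r⃗) = Σ_{i ≤ t} (-1)^i h(a_1, …, â_i, …, a_{t+1}, a_i; r⃗)`), and Theorem H
(the essence of the Artin–Procesi theorem: with `h = h_n(x_1, …, x_t; y⃗) · x_{t+1}`, `t = n²`,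
`h_n(a⃗; r⃗) · a = Σ_i ± h_n(…, â_i, …, a; r⃗) · a_i`, so `A · h_n(a⃗; r⃗)` lies in the `Cent(A)`-span of
`a_1, …, a_{n²}`).

What is here, for the matrix algebra `A = M_n(F)` over a field (the case of PI-class `n` used by the
`MatrixMultiplication` summit), with non-commutative polynomials as elements of Mathlib's
`FreeAlgebra F (Fin (n²) ⊕ Fin m)` evaluated by `FreeAlgebra.lift`:

* `exists_alternatingCentralPolynomial F n` — NAMED FACT (Remark F for `M_n(F)`, `char F = 0`,
  `n ≥ 1`): there is a polynomial `h(x_1, …, x_{n²}; y_1, …, y_m)` whose evaluations on `M_n(F)` are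
  (i) multilinear and alternating in `x⃗` (an `AlternatingMap` in `x⃗` for each `y⃗`), (ii) central,
  (iii) not all zero. The existence of a central polynomial of `M_n` is Formanek 1972 / Razmyslov 1973.
* `alternatingMap_azumaya_identity` — PROVED (the linear algebra behind Lemma G / (1.21) / Theorem H):
  for ANY `F`-algebra `A` of dimension `t` and any alternating `t`-linear `Φ : A^t → A`,
  `Σ_{i=0}^{t} (-1)^i Φ(a_0, …, â_i, …, a_t) · a_i = 0` for all `a_0, …, a_t ∈ A` — the left side is
  Mathlib's `AlternatingMap.alternatizeUncurryFin` of `b ↦ Φ(·) · b`, a `(t+1)`-alternating map on a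
  `t`-dimensional space, which kills the linearly dependent family `a⃗`
  (`AlternatingMap.map_linearDependent`).
* `azumayaIdentity_matrix F n` — NAMED FACT (Theorem H / eq. (1.21) for `M_n(F)`): a central,
  non-identity polynomial `h(x_1, …, x_{n²}; y⃗)` with
  `Σ_{i=0}^{n²} (-1)^i h(a_0, …, â_i, …, a_{n²}; r⃗) · a_i = 0`, i.e.
  `h(a_1, …, a_{n²}; r⃗) · a_0 = Σ_{i ≥ 1} (-1)^{i+1} h(a_0, …, â_i, …, a_{n²}; r⃗) · a_i` with CENTRAL
  coefficients; and `azumayaIdentity_matrix_of` — PROVED: it follows from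
  `exists_alternatingCentralPolynomial` by `alternatingMap_azumaya_identity` (`dim M_n(F) = n²`).

Sign convention: (1.21) is printed with `a_i` moved to the last alternating slot; moving it back costs
`(-1)^{t-i}`, giving the deletion form `Σ_i (-1)^i h(…, â_i, …) a_i = 0` used here (Mathlib's
`Fin.succAbove` / `Fin.removeNth`).

## References

* A. Kanel-Belov, Y. Karasik, L. H. Rowen, *Computational Aspects of Polynomial Identities. Volume I:
  Kemer's Theorems*, 2nd ed., Monographs and Research Notes in Mathematics, CRC Press (2015),
  doi:10.1201/b19411, §1.5.2: Remark F, Lemma G, eq. (1.21), Theorem H. [KanelBelovKarasikRowen2015]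
-/

noncomputable section

namespace Literature.RingTheory.PolynomialIdentities

open scoped BigOperators

/-! ### The Azumaya identity of an alternating form in dimension-many variables (proved) -/

section LinearAlgebra

variable {F : Type*} [Field F] {A : Type*} [Ring A] [Algebra F A]

/-- Right multiplication composed with an alternating form, linearly in the multiplier:
`b ↦ (a⃗ ↦ Φ(a⃗) · b)`. [folklore] -/
def mulRightAlt {t : ℕ} (Φ : A [⋀^Fin t]→ₗ[F] A) : A →ₗ[F] A [⋀^Fin t]→ₗ[F] A where
  toFun b := (LinearMap.mulRight F b).compAlternatingMap Φ
  map_add' b b' := by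
    ext v
    simp only [LinearMap.compAlternatingMap_apply, LinearMap.mulRight_apply, AlternatingMap.add_apply,
      mul_add]
  map_smul' c b := by
    ext v
    simp only [LinearMap.compAlternatingMap_apply, LinearMap.mulRight_apply, AlternatingMap.smul_apply,
      RingHom.id_apply, mul_smul_comm]

/-- Unfolding `mulRightAlt`. [folklore] -/
@[simp] theorem mulRightAlt_apply_apply {t : ℕ} (Φ : A [⋀^Fin t]→ₗ[F] A) (b : A) (v : Fin t → A) :
    mulRightAlt Φ b v = Φ v * b := rfl

/-- **The Azumaya identity (linear algebra of KBKR Lemma G / eq. (1.21) / Theorem H).** If the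
`F`-algebra `A` has dimension `t` and `Φ : A^t → A` is multilinear and alternating, then for all
`a_0, …, a_t ∈ A`, `Σ_{i=0}^{t} (-1)^i Φ(a_0, …, â_i, …, a_t) · a_i = 0`: the left side is a
`(t+1)`-linear alternating function of `(a_0, …, a_t)` (Lemma G), and `t + 1` vectors of a
`t`-dimensional space are linearly dependent. [cite: KanelBelovKarasikRowen2015, §1.5.2 Lemma G and eq. (1.21)] -/
theorem alternatingMap_azumaya_identity [Module.Finite F A] {t : ℕ}
    (ht : Module.finrank F A = t) (Φ : A [⋀^Fin t]→ₗ[F] A) (a : Fin (t + 1) → A) :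
    ∑ i : Fin (t + 1), (-1 : F) ^ (i : ℕ) • (Φ (fun j => a (i.succAbove j)) * a i) = 0 := by
  have hdep : ¬ LinearIndependent F a := fun hli => by
    have := hli.fintype_card_le_finrank
    rw [Fintype.card_fin, ht] at this
    omega
  have h0 := AlternatingMap.map_linearDependent (AlternatingMap.alternatizeUncurryFin (mulRightAlt Φ))
    a hdep
  rw [AlternatingMap.alternatizeUncurryFin_apply] at h0
  have h1 : ∀ i : Fin (t + 1), (-1 : F) ^ (i : ℕ) • (Φ (fun j => a (i.succAbove j)) * a i) =
      (-1 : ℤ) ^ (i : ℕ) • (mulRightAlt Φ (a i)) (i.removeNth a) := by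
    intro i
    rw [mulRightAlt_apply_apply, ← Int.cast_smul_eq_zsmul F, Int.cast_pow, Int.cast_neg, Int.cast_one]
    rfl
  simp_rw [h1]
  exact h0

end LinearAlgebra

/-! ### Named facts for the matrix algebra `M_n(F)` -/

section Matrix

variable (F : Type*) [Field F] (n : ℕ)

/-- **KBKR Remark F for `M_n(F)` (existence of a multilinear `n²`-alternating central polynomial).**
For a field `F` of characteristic `0` and `n ≥ 1` there are `m` and a non-commutative polynomial
`h(x_1, …, x_{n²}; y_1, …, y_m) ∈ F⟨x⃗, y⃗⟩` such that, on `M_n(F)`: (i) for every `y⃗ = r⃗` the evaluation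
`x⃗ ↦ h(x⃗; r⃗)` is a multilinear alternating map of `x⃗ ∈ M_n(F)^{n²}`; (ii) every value `h(x⃗; r⃗)` is
central; (iii) `h` is not an identity of `M_n(F)`. (Take `h = h_n = g(c_{n²}(x⃗, y⃗'), y⃗'')` for a
multilinear central polynomial `g` of `M_n` — Formanek 1972, Razmyslov 1973 — and the Capelli polynomial
`c_{n²}`; `M_n(F)` has PI-class `n`.) [cite: KanelBelovKarasikRowen2015, §1.5.2 Remark F (eq. (1.20))] -/
def exists_alternatingCentralPolynomial : Prop :=
  CharZero F → 1 ≤ n →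
    ∃ (m : ℕ) (h : FreeAlgebra F (Fin (n ^ 2) ⊕ Fin m)),
      (∃ Φ : (Fin m → Matrix (Fin n) (Fin n) F) →
          (Matrix (Fin n) (Fin n) F) [⋀^Fin (n ^ 2)]→ₗ[F] Matrix (Fin n) (Fin n) F,
        ∀ (a : Fin (n ^ 2) → Matrix (Fin n) (Fin n) F) (r : Fin m → Matrix (Fin n) (Fin n) F),
          Φ r a = FreeAlgebra.lift F (Sum.elim a r) h) ∧
      (∀ (x : Fin (n ^ 2) ⊕ Fin m → Matrix (Fin n) (Fin n) F) (M : Matrix (Fin n) (Fin n) F),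
          FreeAlgebra.lift F x h * M = M * FreeAlgebra.lift F x h) ∧
      ∃ x : Fin (n ^ 2) ⊕ Fin m → Matrix (Fin n) (Fin n) F, FreeAlgebra.lift F x h ≠ 0

/-- **KBKR Theorem H / eq. (1.21) for `M_n(F)` (the Azumaya identity of Artin–Procesi–Razmyslov).**
For a field `F` of characteristic `0` and `n ≥ 1` there are `m` and a polynomial
`h(x_1, …, x_{n²}; y_1, …, y_m)`, central and not an identity on `M_n(F)`, such that for all
`a_0, a_1, …, a_{n²}` and `r⃗` in `M_n(F)`:
`Σ_{i=0}^{n²} (-1)^i h(a_0, …, â_i, …, a_{n²}; r⃗) · a_i = 0`, i.e.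
`h(a_1, …, a_{n²}; r⃗) · a_0 = Σ_{i=1}^{n²} (-1)^{i+1} h(a_0, …, â_i, …, a_{n²}; r⃗) · a_i` — every
`a_0 · h(a⃗; r⃗)` is a combination of the FIXED elements `a_1, …, a_{n²}` with CENTRAL coefficients
`± h(a_0, …, â_i, …; r⃗)`. [cite: KanelBelovKarasikRowen2015, §1.5.2 Theorem H and eq. (1.21)] -/
def azumayaIdentity_matrix : Prop :=
  CharZero F → 1 ≤ n →
    ∃ (m : ℕ) (h : FreeAlgebra F (Fin (n ^ 2) ⊕ Fin m)),
      (∀ (x : Fin (n ^ 2) ⊕ Fin m → Matrix (Fin n) (Fin n) F) (M : Matrix (Fin n) (Fin n) F),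
          FreeAlgebra.lift F x h * M = M * FreeAlgebra.lift F x h) ∧
      (∃ x : Fin (n ^ 2) ⊕ Fin m → Matrix (Fin n) (Fin n) F, FreeAlgebra.lift F x h ≠ 0) ∧
      ∀ (a : Fin (n ^ 2 + 1) → Matrix (Fin n) (Fin n) F) (r : Fin m → Matrix (Fin n) (Fin n) F),
        ∑ i : Fin (n ^ 2 + 1), (-1 : F) ^ (i : ℕ) •
          (FreeAlgebra.lift F (Sum.elim (fun j => a (i.succAbove j)) r) h * a i) = 0

variable {F n}

/-- **Theorem H for `M_n(F)` from Remark F**, by the Azumaya identity of alternating forms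
(`alternatingMap_azumaya_identity`, `dim_F M_n(F) = n²`). [cite: KanelBelovKarasikRowen2015, §1.5.2 Theorem H (proof: "take h = h_n(x_1, …, x_t; y⃗) x_{t+1} and apply (1.21)")] -/
theorem azumayaIdentity_matrix_of (hF : exists_alternatingCentralPolynomial F n) :
    azumayaIdentity_matrix F n := by
  intro hchar hn
  obtain ⟨m, h, ⟨Φ, hΦ⟩, hcent, hne⟩ := hF hchar hn
  refine ⟨m, h, hcent, hne, fun a r => ?_⟩
  have hdim : Module.finrank F (Matrix (Fin n) (Fin n) F) = n ^ 2 := by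
    rw [Module.finrank_matrix, Module.finrank_self, Fintype.card_fin]
    ring
  have key := alternatingMap_azumaya_identity hdim (Φ r) a
  simpa only [hΦ] using key

end Matrix

end Literature.RingTheory.PolynomialIdentities
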